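import Summits.QuantumFields.YangMills.Theorems.AllWindowsColdBoxBoxHighLineSmearedFP
import Summits.QuantumFields.YangMills.Theorems.AllWindowsColdBoxBoxHighLineBootstrapPrelims
import Summits.QuantumFields.YangMills.Theorems.AllWindowsColdBoxBoxHighLineLandauDivergence

/-!
# TASK T-S5/U5 step (1), part 2 (T-S5.2): the LOCALISED FADDEEV–POPOV WEIGHT `h_β = exp(−β·Φ)·χ_r` (typing + sanity lemmas)

Planner ym-idea-2 g17's `Cruxes/BoxWindowHighSU2213/STUB-PLAN-S5U5-STEP1.md` (sha12 9448383ae86e), task T-S5.2 — the shared step (1) of the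
XL comparison stubs S5 (LINE-19 ⟨stmt-QuantumFields-24004⟩/⟨24335⟩, `stub_landauSecondOrder`) and U5 (LINE-20 ⟨24336⟩,
`stub_landauThirdOrder`).  The smeared ('t Hooft-averaged) gauge fixing of T-S5.1 `SmearedFPIdentity` (✓p732501's Prop) is applied with
the weight typed here:

* `divDefect U x : Fin 3 → ℝ` — the lattice divergence defect of the su(2)-coordinate one-forms `a^c_e = imVec (U e)_c` at the site `x`,
  `Σ_μ (a(x − e_μ, μ) − a(x, μ))` (sign = the line's `gradVec`: in-flow minus out-flow); `divDefect_eq_gradVec_dotProduct`: at an interior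
  site it IS `gradVec H x ⬝ᵥ a^c` on the Landau free edges (✓`gradVec_dotProduct_eq_interior`).
* `landauPhi H U = Σ_{x ∈ interiorSites H} Σ_c (divDefect U x c)²` — the GAUSSIAN GAUGE-FIXING FUNCTIONAL of FEYNMAN gauge (plan §0:
  `hodgeQ = Qmat + Σ_x gradVec ⊗ gradVec`, and `landauPhi_eq_sum_gradVec_sq` says `Φ(U) = Σ_c Σ_x (gradVec_x ⬝ a^c)²` exactly — the
  div–div half of `a^cᵀ·hodgeQ·a^c`, with the same unit coefficient as `Σ_p cost_p ≈ Σ_c a^cᵀ·Qmat·a^c`).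
  `landauPhi_nonneg`; **`landauPhi_eq_zero_iff : landauPhi H U = 0 ↔ InLandauGauge H U`** (the tree's matrix identity `Σ_μ (U−Uᴴ)(x,μ) =
  Σ_μ (U−Uᴴ)(x−e_μ,μ)` read through `W − Wᴴ = hat(imVec W)`, `sub_conjTranspose_eq_suHat`); `continuous_landauPhi`, `measurable_landauPhi`.
* `linkBump r t = min 1 (max 0 ((4r² − t)/(3r²)))` — one-link cutoff profile: `= 1` for `t ≤ r²`, `= 0` for `t ≥ 4r²`, values in `[0,1]`,
  continuous (Lipschitz; smoothness is never used downstream: on the concentration region of T-S5.4 the cutoff is identically `1` by T-S5.3).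
* `ballCutoff H r U = ∏_{e ∈ boxEdges 4 (2H+1)} linkBump r (linkDefect U e)` — `= 1` when every box link has defect `≤ r²`, `= 0` as soon as
  one box link has defect `≥ 4r²` (`ballCutoff_eq_one`, `ballCutoff_eq_zero`, support lemma `linkDefect_lt_of_ballCutoff_ne_zero`), in `[0,1]`,
  continuous/measurable; gauge-DEPENDENT by design.
* `fpWeight β H r U = exp(−β·landauPhi H U) · ballCutoff H r U` ∈ `[0,1]` for `β ≥ 0`, continuous, measurable; the floored weight
  `fpWeight β H r U + ε` satisfies the hypotheses of `SmearedFPIdentity`: measurable, `≥ 0`, `≤ 1 + ε`, and — `orbitAverage_fpWeight_floor_pos` —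
  its orbit average is `≥ ε > 0` EVERYWHERE (`orbitAverage_add_const`, `orbitAverage_nonneg`; the interior-gauge action is jointly continuous,
  `continuous_gaugeAction_extendGauge`, and `interiorGaugeMeasure H` is a probability measure, ✓`isProbabilityMeasure_interiorGaugeMeasure` of T-S5.1).

HONEST LABEL: typing + sanity lemmas of ONE shared step of two XL stubs; S5, U5, ⟨24004⟩ ⟨24335⟩ ⟨24336⟩ remain OPEN; no crux, rung or summit is
proved; the Yang–Mills mass gap is NOT proved by this file.
-/

set_option autoImplicit false

noncomputable section

open MeasureTheory Matrix Finset
open Literature.MathematicalPhysics.QuantumFieldTheory hiding boxEdges ZdEdge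
open Literature.MathematicalPhysics.QuantumFieldTheory.LatticeMaxwell
open Literature.MathematicalPhysics.QuantumFieldTheory.AxialGauge
open Literature.MathematicalPhysics.QuantumLattice
open Summit.QuantumFields.YangMills.Theorems.WeakCouplingRates
open Literature.Probability.LatticeModels (Site)

namespace Summit.QuantumFields.YangMills.Theorems.AllWindowsColdBoxBoxHighLine

/-! ## The divergence defect and the gauge-fixing functional `Φ` -/

/-- The lattice divergence defect at the site `x` of the su(2)-coordinate one-forms `a^c_e = imVec (U e)_c`:
`Σ_μ (a(x − e_μ, μ) − a(x, μ))` (in-flow minus out-flow, the sign of the line's `gradVec`), as a vector in `ℝ³`. -/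
def divDefect (U : LGConfig 4 SU2) (x : Site 4) : Fin 3 → ℝ :=
  ∑ μ : Fin 4, (imVec (U (x - Pi.single μ 1, μ)) - imVec (U (x, μ)))

/-- **The Gaussian (Feynman-gauge) gauge-fixing functional** `Φ(U) = Σ_{x interior} ‖divDefect U x‖²`. -/
def landauPhi (H : ℕ) (U : LGConfig 4 SU2) : ℝ :=
  ∑ x ∈ interiorSites H, ∑ c : Fin 3, divDefect U x c ^ 2

/-- Componentwise formula for the divergence defect. -/
theorem divDefect_apply (U : LGConfig 4 SU2) (x : Site 4) (c : Fin 3) :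
    divDefect U x c = ∑ μ : Fin 4, (imVec (U (x - Pi.single μ 1, μ)) c - imVec (U (x, μ)) c) := by
  simp only [divDefect, Finset.sum_apply, Pi.sub_apply]

/-- **At an interior site the divergence defect is `gradVec H x ⬝ᵥ a^c`** on the Landau free edges (✓`gradVec_dotProduct_eq_interior`). -/
theorem divDefect_eq_gradVec_dotProduct {H : ℕ} (U : LGConfig 4 SU2) {x : Site 4} (hx : x ∈ interiorSites H) (c : Fin 3) :
    divDefect U x c = gradVec H x ⬝ᵥ fun i : LandauFree H => imVec (U i.1.1) c := by
  rw [gradVec_dotProduct_eq_interior hx, divDefect_apply, Finset.sum_sub_distrib]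
  rfl

/-- `Φ ≥ 0`. -/
theorem landauPhi_nonneg (H : ℕ) (U : LGConfig 4 SU2) : 0 ≤ landauPhi H U :=
  Finset.sum_nonneg fun _ _ => Finset.sum_nonneg fun _ _ => sq_nonneg _

/-- **`Φ` is the div–div half of the Hodge form**: `Φ(U) = Σ_c Σ_{x interior} (gradVec_x ⬝ a^c)²`, `a^c_e = imVec (U e)_c`. -/
theorem landauPhi_eq_sum_gradVec_sq (H : ℕ) (U : LGConfig 4 SU2) :
    landauPhi H U = ∑ x ∈ interiorSites H, ∑ c : Fin 3, (gradVec H x ⬝ᵥ fun i : LandauFree H => imVec (U i.1.1) c) ^ 2 := by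
  unfold landauPhi
  refine Finset.sum_congr rfl fun x hx => Finset.sum_congr rfl fun c _ => ?_
  rw [divDefect_eq_gradVec_dotProduct U hx c]

/-! ## `Φ = 0 ⇔ InLandauGauge` -/

/-- The `su(2)` hat map: the anti-Hermitian traceless matrix with vector part `v` (normalised so that `W − Wᴴ = suHat (imVec W)`). -/
def suHat (v : Fin 3 → ℝ) : Matrix (Fin 2) (Fin 2) ℂ :=
  !![2 * (v 0 : ℂ) * Complex.I, -(2 * ((v 1 : ℂ) - (v 2 : ℂ) * Complex.I));
    2 * ((v 1 : ℂ) + (v 2 : ℂ) * Complex.I), -(2 * (v 0 : ℂ) * Complex.I)]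

/-- `suHat` is additive. -/
theorem suHat_add (v w : Fin 3 → ℝ) : suHat (v + w) = suHat v + suHat w := by
  ext i j
  fin_cases i <;> fin_cases j <;> simp [suHat] <;> ring

/-- `suHat 0 = 0`. -/
theorem suHat_zero : suHat 0 = 0 := by
  ext i j
  fin_cases i <;> fin_cases j <;> simp [suHat]

/-- `suHat` over finite sums. -/
theorem suHat_sum {ι : Type*} (s : Finset ι) (v : ι → Fin 3 → ℝ) : suHat (∑ k ∈ s, v k) = ∑ k ∈ s, suHat (v k) := by
  classical
  induction s using Finset.induction_on with
  | empty => simp [suHat_zero]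
  | insert a s ha ih => rw [Finset.sum_insert ha, Finset.sum_insert ha, suHat_add, ih]

/-- `imVecM (suHat v) = 2v`: the hat map is injective. -/
theorem imVecM_suHat (v : Fin 3 → ℝ) (c : Fin 3) : imVecM (suHat v) c = 2 * v c := by
  fin_cases c <;> simp [imVecM, suHat]

/-- `suHat` is injective. -/
theorem suHat_injective : Function.Injective suHat := fun v w h => by
  funext c
  have h2 := congrArg (fun M => imVecM M c) h
  simp only [imVecM_suHat] at h2
  linarith

/-- **`W − Wᴴ = suHat (imVec W)` for `W ∈ SU(2)`** (`W = [[α, −β̄],[β, ᾱ]]`, `imVec W = (Im α, Re β, Im β)`). -/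
theorem sub_conjTranspose_eq_suHat (W : SU2) :
    (W : Matrix (Fin 2) (Fin 2) ℂ) - (W : Matrix (Fin 2) (Fin 2) ℂ)ᴴ = suHat (imVec W) := by
  have h01 := apply_zero_one_eq_neg_conj W
  have h11 := su2_apply_11 W
  ext i j
  fin_cases i <;> fin_cases j <;> apply Complex.ext <;>
    simp [suHat, imVec, Matrix.conjTranspose_apply, h01, h11] <;> ring

/-- The Landau matrix identity at `x` is the vanishing of the divergence defect at `x`. -/
theorem landau_at_iff_divDefect_eq_zero (U : LGConfig 4 SU2) (x : Site 4) :
    (∑ μ : Fin 4, ((U (x, μ) : Matrix (Fin 2) (Fin 2) ℂ) - (U (x, μ) : Matrix (Fin 2) (Fin 2) ℂ)ᴴ)) =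
      ∑ μ : Fin 4, ((U (x - Pi.single μ 1, μ) : Matrix (Fin 2) (Fin 2) ℂ) - (U (x - Pi.single μ 1, μ) : Matrix (Fin 2) (Fin 2) ℂ)ᴴ)
    ↔ divDefect U x = 0 := by
  simp only [sub_conjTranspose_eq_suHat, ← suHat_sum]
  rw [suHat_injective.eq_iff, divDefect, Finset.sum_sub_distrib, sub_eq_zero, eq_comm]

/-- **`Φ(U) = 0` iff `U` is in lattice Landau gauge at the interior sites.** -/
theorem landauPhi_eq_zero_iff {H : ℕ} (U : LGConfig 4 SU2) : landauPhi H U = 0 ↔ InLandauGauge H U := by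
  unfold landauPhi InLandauGauge
  rw [Finset.sum_eq_zero_iff_of_nonneg fun x _ => Finset.sum_nonneg fun c _ => sq_nonneg (divDefect U x c)]
  refine forall₂_congr fun x _ => ?_
  rw [landau_at_iff_divDefect_eq_zero, Finset.sum_eq_zero_iff_of_nonneg fun c _ => sq_nonneg (divDefect U x c)]
  simp only [Finset.mem_univ, true_implies, sq_eq_zero_iff]
  exact Iff.symm funext_iff

/-- In Landau gauge `Φ = 0`. -/
theorem landauPhi_eq_zero_of_inLandauGauge {H : ℕ} {U : LGConfig 4 SU2} (hU : InLandauGauge H U) : landauPhi H U = 0 :=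
  (landauPhi_eq_zero_iff U).2 hU

/-! ## Continuity / measurability of the chart and of `Φ` -/

/-- The su(2)-coordinates of a fixed link are continuous on configuration space. -/
theorem continuous_imVec_apply (e : ZdEdge 4) (c : Fin 3) : Continuous fun U : LGConfig 4 SU2 => imVec (U e) c := by
  have hW : Continuous fun U : LGConfig 4 SU2 => ((U e : SU2) : Matrix (Fin 2) (Fin 2) ℂ) :=
    continuous_subtype_val.comp (continuous_apply e)
  have hent : ∀ i j : Fin 2, Continuous fun U : LGConfig 4 SU2 => ((U e : SU2) : Matrix (Fin 2) (Fin 2) ℂ) i j := fun i j =>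
    (continuous_apply j).comp ((continuous_apply i).comp hW)
  fin_cases c
  · exact Complex.continuous_im.comp (hent 0 0)
  · exact Complex.continuous_re.comp (hent 1 0)
  · exact Complex.continuous_im.comp (hent 1 0)

/-- The divergence defect is continuous. -/
theorem continuous_divDefect (x : Site 4) (c : Fin 3) : Continuous fun U : LGConfig 4 SU2 => divDefect U x c := by
  simp only [divDefect_apply]
  exact continuous_finsetSum _ fun μ _ => (continuous_imVec_apply _ c).sub (continuous_imVec_apply _ c)

/-- `Φ` is continuous. -/
theorem continuous_landauPhi (H : ℕ) : Continuous (landauPhi H) := by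
  unfold landauPhi
  exact continuous_finsetSum _ fun x _ => continuous_finsetSum _ fun c _ => (continuous_divDefect x c).pow 2

/-- `Φ` is measurable. -/
theorem measurable_landauPhi (H : ℕ) : Measurable (landauPhi H) := by
  haveI : SecondCountableTopology SU2 := inferInstance
  exact (continuous_landauPhi H).measurable

/-- The link defect of a fixed edge is continuous on configuration space. -/
theorem continuous_linkDefect (e : ZdEdge 4) : Continuous fun U : LGConfig 4 SU2 => linkDefect U e := by
  have hW : Continuous fun U : LGConfig 4 SU2 => ((U e : SU2) : Matrix (Fin 2) (Fin 2) ℂ) :=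
    continuous_subtype_val.comp (continuous_apply e)
  have htr : Continuous fun U : LGConfig 4 SU2 => (((U e : SU2) : Matrix (Fin 2) (Fin 2) ℂ).trace).re := by
    simp only [Matrix.trace_fin_two]
    exact Complex.continuous_re.comp
      (((continuous_apply (0 : Fin 2)).comp ((continuous_apply (0 : Fin 2)).comp hW)).add
        ((continuous_apply (1 : Fin 2)).comp ((continuous_apply (1 : Fin 2)).comp hW)))
  exact continuous_const.sub htr

/-! ## The one-link bump and the ball cutoff `χ_r` -/

/-- One-link cutoff profile in the defect variable `t`: `1` on `t ≤ r²`, `0` on `t ≥ 4r²`, linear in between. -/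
def linkBump (r t : ℝ) : ℝ := min 1 (max 0 ((4 * r ^ 2 - t) / (3 * r ^ 2)))

/-- `0 ≤ linkBump r t`. -/
theorem linkBump_nonneg (r t : ℝ) : 0 ≤ linkBump r t :=
  le_min zero_le_one (le_max_left _ _)

/-- `linkBump r t ≤ 1`. -/
theorem linkBump_le_one (r t : ℝ) : linkBump r t ≤ 1 := min_le_left _ _

/-- On `t ≤ r²` (`r ≠ 0`) the bump is `1`. -/
theorem linkBump_eq_one {r t : ℝ} (hr : r ≠ 0) (ht : t ≤ r ^ 2) : linkBump r t = 1 := by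
  have hr2 : 0 < r ^ 2 := by positivity
  have h1 : 1 ≤ (4 * r ^ 2 - t) / (3 * r ^ 2) := by
    rw [le_div_iff₀ (by positivity)]; linarith
  unfold linkBump
  rw [min_eq_left]
  exact h1.trans (le_max_right _ _)

/-- On `t ≥ 4r²` the bump is `0`. -/
theorem linkBump_eq_zero {r t : ℝ} (ht : 4 * r ^ 2 ≤ t) : linkBump r t = 0 := by
  unfold linkBump
  have h : (4 * r ^ 2 - t) / (3 * r ^ 2) ≤ 0 := div_nonpos_of_nonpos_of_nonneg (by linarith) (by positivity)
  rw [max_eq_left h, min_eq_right zero_le_one]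

/-- If the bump does not vanish then `t < 4r²`. -/
theorem lt_of_linkBump_ne_zero {r t : ℝ} (h : linkBump r t ≠ 0) : t < 4 * r ^ 2 := by
  by_contra hc
  exact h (linkBump_eq_zero (not_lt.1 hc))

/-- The bump is continuous in `t`. -/
theorem continuous_linkBump (r : ℝ) : Continuous (linkBump r) := by
  unfold linkBump
  exact continuous_const.min (continuous_const.max ((continuous_const.sub continuous_id).div_const _))

/-- **The ball cutoff** `χ_r(U) = ∏_{e ∈ boxEdges 4 (2H+1)} linkBump r (linkDefect U e)`. -/
def ballCutoff (H : ℕ) (r : ℝ) (U : LGConfig 4 SU2) : ℝ :=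
  ∏ e ∈ boxEdges 4 (2 * H + 1), linkBump r (linkDefect U e)

/-- `0 ≤ χ_r`. -/
theorem ballCutoff_nonneg (H : ℕ) (r : ℝ) (U : LGConfig 4 SU2) : 0 ≤ ballCutoff H r U :=
  Finset.prod_nonneg fun _ _ => linkBump_nonneg _ _

/-- `χ_r ≤ 1`. -/
theorem ballCutoff_le_one (H : ℕ) (r : ℝ) (U : LGConfig 4 SU2) : ballCutoff H r U ≤ 1 :=
  Finset.prod_le_one (fun _ _ => linkBump_nonneg _ _) fun _ _ => linkBump_le_one _ _

/-- `χ_r(U) = 1` when every box link has defect `≤ r²` (`r ≠ 0`). -/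
theorem ballCutoff_eq_one {H : ℕ} {r : ℝ} (hr : r ≠ 0) {U : LGConfig 4 SU2}
    (h : ∀ e ∈ boxEdges 4 (2 * H + 1), linkDefect U e ≤ r ^ 2) : ballCutoff H r U = 1 :=
  Finset.prod_eq_one fun e he => linkBump_eq_one hr (h e he)

/-- `χ_r(U) = 0` as soon as one box link has defect `≥ 4r²`. -/
theorem ballCutoff_eq_zero {H : ℕ} {r : ℝ} {U : LGConfig 4 SU2} {e : ZdEdge 4} (he : e ∈ boxEdges 4 (2 * H + 1))
    (h : 4 * r ^ 2 ≤ linkDefect U e) : ballCutoff H r U = 0 :=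
  Finset.prod_eq_zero he (linkBump_eq_zero h)

/-- **Support of the cutoff**: if `χ_r(U) ≠ 0` then every box link has defect `< 4r²` (the `2r`-ball). -/
theorem linkDefect_lt_of_ballCutoff_ne_zero {H : ℕ} {r : ℝ} {U : LGConfig 4 SU2} (h : ballCutoff H r U ≠ 0)
    {e : ZdEdge 4} (he : e ∈ boxEdges 4 (2 * H + 1)) : linkDefect U e < 4 * r ^ 2 := by
  by_contra hc
  exact h (ballCutoff_eq_zero he (not_lt.1 hc))

/-- `χ_r` is continuous. -/
theorem continuous_ballCutoff (H : ℕ) (r : ℝ) : Continuous (ballCutoff H r) := by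
  unfold ballCutoff
  exact continuous_finsetProd _ fun e _ => (continuous_linkBump r).comp (continuous_linkDefect e)

/-- `χ_r` is measurable. -/
theorem measurable_ballCutoff (H : ℕ) (r : ℝ) : Measurable (ballCutoff H r) := by
  haveI : SecondCountableTopology SU2 := inferInstance
  exact (continuous_ballCutoff H r).measurable

/-! ## The localised Faddeev–Popov weight `h_β = exp(−βΦ)·χ_r` -/

/-- **The localised smeared-gauge-fixing weight** `h_β(U) = exp(−β·Φ(U)) · χ_r(U)`. -/
def fpWeight (β : ℝ) (H : ℕ) (r : ℝ) (U : LGConfig 4 SU2) : ℝ :=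
  Real.exp (-(β * landauPhi H U)) * ballCutoff H r U

/-- `0 ≤ h_β`. -/
theorem fpWeight_nonneg (β : ℝ) (H : ℕ) (r : ℝ) (U : LGConfig 4 SU2) : 0 ≤ fpWeight β H r U :=
  mul_nonneg (Real.exp_nonneg _) (ballCutoff_nonneg H r U)

/-- `h_β ≤ 1` for `β ≥ 0`. -/
theorem fpWeight_le_one {β : ℝ} (hβ : 0 ≤ β) (H : ℕ) (r : ℝ) (U : LGConfig 4 SU2) : fpWeight β H r U ≤ 1 := by
  have h1 : Real.exp (-(β * landauPhi H U)) ≤ 1 :=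
    Real.exp_le_one_iff.2 (neg_nonpos.2 (mul_nonneg hβ (landauPhi_nonneg H U)))
  calc fpWeight β H r U ≤ 1 * 1 :=
        mul_le_mul h1 (ballCutoff_le_one H r U) (ballCutoff_nonneg H r U) zero_le_one
    _ = 1 := one_mul 1

/-- `h_β` is continuous. -/
theorem continuous_fpWeight (β : ℝ) (H : ℕ) (r : ℝ) : Continuous (fpWeight β H r) := by
  unfold fpWeight
  exact (Real.continuous_exp.comp ((continuous_const.mul (continuous_landauPhi H)).neg)).mul (continuous_ballCutoff H r)

/-- `h_β` is measurable. -/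
theorem measurable_fpWeight (β : ℝ) (H : ℕ) (r : ℝ) : Measurable (fpWeight β H r) := by
  haveI : SecondCountableTopology SU2 := inferInstance
  exact (continuous_fpWeight β H r).measurable

/-- The floored weight `h_β + ε` is measurable. -/
theorem measurable_fpWeight_add_const (β : ℝ) (H : ℕ) (r ε : ℝ) : Measurable fun U => fpWeight β H r U + ε :=
  (measurable_fpWeight β H r).add_const ε

/-- The floored weight is nonnegative for `ε ≥ 0`. -/
theorem fpWeight_add_const_nonneg (β : ℝ) (H : ℕ) (r : ℝ) {ε : ℝ} (hε : 0 ≤ ε) (U : LGConfig 4 SU2) :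
    0 ≤ fpWeight β H r U + ε :=
  add_nonneg (fpWeight_nonneg β H r U) hε

/-- The floored weight is bounded by `1 + ε` for `β ≥ 0`. -/
theorem fpWeight_add_const_le {β : ℝ} (hβ : 0 ≤ β) (H : ℕ) (r ε : ℝ) (U : LGConfig 4 SU2) :
    fpWeight β H r U + ε ≤ 1 + ε :=
  add_le_add (fpWeight_le_one hβ H r U) le_rfl

/-- On the support of the weight every box link lies in the `2r`-ball. -/
theorem linkDefect_lt_of_fpWeight_ne_zero {β : ℝ} {H : ℕ} {r : ℝ} {U : LGConfig 4 SU2} (h : fpWeight β H r U ≠ 0)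
    {e : ZdEdge 4} (he : e ∈ boxEdges 4 (2 * H + 1)) : linkDefect U e < 4 * r ^ 2 :=
  linkDefect_lt_of_ballCutoff_ne_zero (right_ne_zero_of_mul h) he

/-- In Landau gauge with all box links in the `r`-ball the weight is `1` (the maximum). -/
theorem fpWeight_eq_one {β : ℝ} {H : ℕ} {r : ℝ} (hr : r ≠ 0) {U : LGConfig 4 SU2} (hL : InLandauGauge H U)
    (h : ∀ e ∈ boxEdges 4 (2 * H + 1), linkDefect U e ≤ r ^ 2) : fpWeight β H r U = 1 := by
  rw [fpWeight, landauPhi_eq_zero_of_inLandauGauge hL, mul_zero, neg_zero, Real.exp_zero, ballCutoff_eq_one hr h, mul_one]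

/-! ## Orbit averages of floored weights are positive -/

/-- The extended interior gauge transformation is jointly continuous in `(g, x)`-data: each value `extendGauge H g x` is continuous in `g`. -/
theorem continuous_extendGauge_apply (H : ℕ) (x : Site 4) : Continuous fun g : InteriorGauge H => extendGauge H g x := by
  by_cases hx : x ∈ interiorSites H
  · simp only [extendGauge, dif_pos hx]; exact continuous_apply _
  · simp only [extendGauge, dif_neg hx]; exact continuous_const

/-- **Joint continuity of the interior gauge action** `(g, U) ↦ U^{extendGauge H g}`. -/
theorem continuous_gaugeAction_extendGauge (H : ℕ) :
    Continuous fun p : InteriorGauge H × LGConfig 4 SU2 => gaugeTransformZd (extendGauge H p.1) p.2 := by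
  refine continuous_pi fun e => ?_
  show Continuous fun p : InteriorGauge H × LGConfig 4 SU2 =>
    extendGauge H p.1 e.1 * p.2 e * (extendGauge H p.1 (e.1 + Pi.single e.2 1))⁻¹
  exact (((continuous_extendGauge_apply H e.1).comp continuous_fst).mul ((continuous_apply e).comp continuous_snd)).mul
    ((continuous_extendGauge_apply H _).comp continuous_fst).inv

/-- Continuity of the orbit map `g ↦ U^{extendGauge H g}` of a fixed configuration. -/
theorem continuous_gaugeTransformZd_extendGauge (H : ℕ) (U : LGConfig 4 SU2) :
    Continuous fun g : InteriorGauge H => gaugeTransformZd (extendGauge H g) U := by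
  refine continuous_pi fun e => ?_
  show Continuous fun g : InteriorGauge H => extendGauge H g e.1 * U e * (extendGauge H g (e.1 + Pi.single e.2 1))⁻¹
  exact ((continuous_extendGauge_apply H e.1).mul continuous_const).mul (continuous_extendGauge_apply H _).inv

/-- A continuous weight is integrable along every orbit (compact gauge group, probability measure). -/
theorem integrable_orbit {H : ℕ} {h : LGConfig 4 SU2 → ℝ} (hc : Continuous h) (U : LGConfig 4 SU2) :
    Integrable (fun g : InteriorGauge H => h (gaugeTransformZd (extendGauge H g) U)) (interiorGaugeMeasure H) := by
  haveI := isProbabilityMeasure_interiorGaugeMeasure H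
  exact (hc.comp (continuous_gaugeTransformZd_extendGauge H U)).integrable_of_hasCompactSupport
    (HasCompactSupport.of_compactSpace _)

/-- Orbit averages of nonnegative weights are nonnegative. -/
theorem orbitAverage_nonneg {H : ℕ} {h : LGConfig 4 SU2 → ℝ} (h0 : ∀ U, 0 ≤ h U) (U : LGConfig 4 SU2) : 0 ≤ orbitAverage H h U :=
  integral_nonneg fun _ => h0 _

/-- **Orbit average of a floored weight**: `N_{h+ε}(U) = N_h(U) + ε` for a continuous weight `h`. -/
theorem orbitAverage_add_const {H : ℕ} {h : LGConfig 4 SU2 → ℝ} (hc : Continuous h) (ε : ℝ) (U : LGConfig 4 SU2) :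
    orbitAverage H (fun V => h V + ε) U = orbitAverage H h U + ε := by
  haveI := isProbabilityMeasure_interiorGaugeMeasure H
  unfold orbitAverage
  rw [integral_add (integrable_orbit hc U) (integrable_const (μ := interiorGaugeMeasure H) ε), integral_const, smul_eq_mul,
    probReal_univ, one_mul]

/-- **Positivity of the floored orbit average**: `N_{h+ε}(U) ≥ ε > 0` for a continuous weight `h ≥ 0` and `ε > 0`. -/
theorem orbitAverage_add_const_pos {H : ℕ} {h : LGConfig 4 SU2 → ℝ} (hc : Continuous h) (h0 : ∀ U, 0 ≤ h U) {ε : ℝ} (hε : 0 < ε)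
    (U : LGConfig 4 SU2) : 0 < orbitAverage H (fun V => h V + ε) U := by
  rw [orbitAverage_add_const hc ε U]
  exact add_pos_of_nonneg_of_pos (orbitAverage_nonneg h0 U) hε

/-- **The floored FP weight has everywhere-positive orbit average** (`≥ ε`): the hypothesis `0 < orbitAverage` of `SmearedFPIdentity`. -/
theorem orbitAverage_fpWeight_floor_pos (β : ℝ) (H : ℕ) (r : ℝ) {ε : ℝ} (hε : 0 < ε) (U : LGConfig 4 SU2) :
    0 < orbitAverage H (fun V => fpWeight β H r V + ε) U :=
  orbitAverage_add_const_pos (continuous_fpWeight β H r) (fpWeight_nonneg β H r) hε U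

/-- The lower bound itself: `ε ≤ N_{h_β+ε}(U)`. -/
theorem le_orbitAverage_fpWeight_floor (β : ℝ) (H : ℕ) (r ε : ℝ) (U : LGConfig 4 SU2) :
    ε ≤ orbitAverage H (fun V => fpWeight β H r V + ε) U := by
  rw [orbitAverage_add_const (continuous_fpWeight β H r) ε U]
  exact le_add_of_nonneg_left (orbitAverage_nonneg (fpWeight_nonneg β H r) U)

/-- And the upper bound `N_{h_β+ε}(U) ≤ 1 + ε` for `β ≥ 0`. -/
theorem orbitAverage_fpWeight_floor_le {β : ℝ} (hβ : 0 ≤ β) (H : ℕ) (r ε : ℝ) (U : LGConfig 4 SU2) :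
    orbitAverage H (fun V => fpWeight β H r V + ε) U ≤ 1 + ε := by
  haveI := isProbabilityMeasure_interiorGaugeMeasure H
  rw [orbitAverage_add_const (continuous_fpWeight β H r) ε U]
  refine add_le_add ?_ le_rfl
  unfold orbitAverage
  have h := integral_mono (integrable_orbit (continuous_fpWeight β H r) U)
    (integrable_const (μ := interiorGaugeMeasure H) (1 : ℝ))
    fun g => fpWeight_le_one hβ H r _
  simpa only [integral_const, smul_eq_mul, probReal_univ, one_mul] using h

/-! ## Appendix (same seat, appended): T-S5.1 ∘ T-S5.2 — the smeared identity with the floored localised weight -/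

/-- **The smeared Faddeev–Popov identity for the floored localised weight** `h = h_{βw} + ε` (`βw ≥ 0`, `ε > 0`; the plan takes `βw = β`):
`∫ F · (h_{βw} + ε) / N_{h_{βw}+ε} ∂boxState = ∫ F ∂boxState` for every interior-gauge-invariant integrable `F` (✓`smearedFPIdentity` + this file). -/
theorem integral_mul_fpWeight_floor_div_orbitAverage_eq (β : ℝ) (H : ℕ) {βw : ℝ} (hβw : 0 ≤ βw) (r : ℝ) {ε : ℝ} (hε : 0 < ε)
    {F : LGConfig 4 SU2 → ℝ} (hF : ∀ g : InteriorGauge H, ∀ U, F (gaugeTransformZd (extendGauge H g) U) = F U)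
    (hFi : Integrable F (boxState (fundamentalRep (Fin 2)) β H)) :
    ∫ U, F U * ((fpWeight βw H r U + ε) / orbitAverage H (fun V => fpWeight βw H r V + ε) U) ∂(boxState (fundamentalRep (Fin 2)) β H) =
      ∫ U, F U ∂(boxState (fundamentalRep (Fin 2)) β H) :=
  smearedFPIdentity β H F (fun V => fpWeight βw H r V + ε) hF hFi (measurable_fpWeight_add_const βw H r ε)
    (fpWeight_add_const_nonneg βw H r hε.le) ⟨1 + ε, fpWeight_add_const_le hβw H r ε⟩ (orbitAverage_fpWeight_floor_pos βw H r hε)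

end Summit.QuantumFields.YangMills.Theorems.AllWindowsColdBoxBoxHighLine

end
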